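import Summits.QuantumFields.YangMills.Theorems.UnitScaleTiltSmoothLiftInterpTools
import HarnessLib

/-!
# Route `UnitScaleTilt`, crux K1 child «MinimiserStabilityRegPr» (stmt-QuantumFields-19200), stub `stub_smoothLift` (G-K1a-2′) — helper P2b:
# THE PLAQUETTE VARIABLES OF THE SMOOTH INTERPOLATION ARE `exp(F_{κλ}(y)/L²)` TO SECOND ORDER

Fleet seat `ym-ust-19200-p2` (gen 0).  For a coarse `SU(2)` field `V` with plaquettes `|V(∂p) − 1| ≤ a` ((4d+2)a ≤ 1) and
covariant-constancy defect `‖V(y,κ)F(y+e_κ)V(y,κ)* − F(y)‖ ≤ b′`, EVERY fine plaquette `p = ⟨x, κ, λ⟩` (`x ∈ B(y)`; interior, face or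
edge) of the interpolation `interp V` (`UnitScaleTiltSmoothLiftInterpDefs`) satisfies
  `‖interp V (∂p) − exp(F_{κλ}(y)/L²)‖ ≤ 2((4d+2)a)² + 3d·b′`   (**`norm_plaqHol_interp_sub_exp_le`**):
the coarse curvature of the block is spread UNIFORMLY over the `L^d` fine plaquettes of each plane — the mechanism by which the
lift carries `L^{d−4}` of the Wilson action (G-K1a-2′ clause (iv)).  §7: sizes of `F`, `B` and the potential one step away
(`+F/(2L²)` inside, `−(L−1)F/(2L²) + O(b′)` across a face after transport); §8: the five exponents of §6 of the tools file sum to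
`F/L²` EXACTLY at first order in each exit configuration (**`exists_sum_exponents`**), and §3 of the tools file converts the product.
[cite: King1986, (A.5) p.676; Balaban1987RG1, (0.3)-(0.4) p.252]
-/

noncomputable section

open NormedSpace
open scoped Matrix.Norms.L2Operator BigOperators

namespace Summit.QuantumFields.YangMills.Theorems.SmoothLiftInterp

open Literature.MathematicalPhysics.QuantumFieldTheory.Balaban1983to89
open MatrixLog T4Continuum AveragingRT BlockAveraging BlockAveragingSection BlockAveragingSectionPlaq

/-! ## §7 Sizes: curvature, potential; the potential one step away -/

section Sizes

variable {P : Params} {j : ℕ}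

/-- `‖F_{κλ}(y)‖ ≤ 2|V(∂p) − 1|` ((26) of [Balaban1985Averaging] on the guard; `0` off it). [cite: Balaban1985Averaging, (26) p.22] -/
theorem norm_curv_le (V : GaugeField P (j+1) (Matrix.specialUnitaryGroup (Fin 2) ℂ)) (y : Site P (j+1)) (κ μ : Fin P.d) :
    ‖curv V y κ μ‖ ≤ 2 * ‖((plaqElt V y κ μ : Matrix.specialUnitaryGroup (Fin 2) ℂ) : Matrix (Fin 2) (Fin 2) ℂ) - 1‖ := by
  by_cases h : ‖((plaqElt V y κ μ : Matrix.specialUnitaryGroup (Fin 2) ℂ) : Matrix (Fin 2) (Fin 2) ℂ) - 1‖ ≤ 1 / 3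
  · rw [curv_of_small h]; exact norm_mlog_le_two_mul (h.trans (by norm_num))
  · rw [curv_of_not_small h, norm_zero]; positivity

/-- `‖B_λ(x)‖ ≤ d·(L−1)·M/(4L²)` when all `‖F_{ρλ}(blockOf x)‖ ≤ M` (`|n_ρ| ≤ (L−1)/2`). [folklore] -/
theorem norm_pot_le (V : GaugeField P (j+1) (Matrix.specialUnitaryGroup (Fin 2) ℂ)) (x : Site P j) (μ : Fin P.d) {M : ℝ}
    (hM : ∀ ρ, ‖curv V (blockOf x) ρ μ‖ ≤ M) :
    ‖pot V x μ‖ ≤ (P.d : ℝ) * (((P.L : ℝ) - 1) / 2) * M / (2 * (P.L : ℝ) ^ 2) := by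
  have hL : (0 : ℝ) < P.L := Nat.cast_pos.mpr P.L_pos
  have hM0 : 0 ≤ M := (norm_nonneg _).trans (hM μ)
  unfold pot
  rw [norm_smul, Real.norm_of_nonneg (by positivity)]
  have hsum : ‖∑ ρ : Fin P.d, coff x ρ • curv V (blockOf x) ρ μ‖ ≤ (P.d : ℝ) * (((P.L : ℝ) - 1) / 2 * M) := by
    calc ‖∑ ρ : Fin P.d, coff x ρ • curv V (blockOf x) ρ μ‖ ≤ ∑ ρ : Fin P.d, ‖coff x ρ • curv V (blockOf x) ρ μ‖ := norm_sum_le _ _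
      _ ≤ ∑ _ρ : Fin P.d, ((P.L : ℝ) - 1) / 2 * M := Finset.sum_le_sum fun ρ _ => by
          rw [norm_smul, Real.norm_eq_abs]
          exact mul_le_mul (abs_coff_le x ρ) (hM ρ) (norm_nonneg _) (by linarith [abs_nonneg (coff x ρ), abs_coff_le x ρ])
      _ = (P.d : ℝ) * (((P.L : ℝ) - 1) / 2 * M) := by rw [Finset.sum_const, Finset.card_univ, Fintype.card_fin, nsmul_eq_mul]
  calc 1 / (2 * (P.L : ℝ) ^ 2) * ‖∑ ρ : Fin P.d, coff x ρ • curv V (blockOf x) ρ μ‖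
      ≤ 1 / (2 * (P.L : ℝ) ^ 2) * ((P.d : ℝ) * (((P.L : ℝ) - 1) / 2 * M)) := by gcongr
    _ = _ := by ring

/-- Crude form: `‖s(b)·B_λ(x)‖ ≤ d·M/2` for both weights `s ∈ {1, L+1}` (`(L+1)(L−1) ≤ 2L²·…`). [folklore] -/
theorem norm_wt_smul_pot_le (V : GaugeField P (j+1) (Matrix.specialUnitaryGroup (Fin 2) ℂ)) (b : PBond P j) (x : Site P j)
    (μ : Fin P.d) {M : ℝ} (hM : ∀ ρ, ‖curv V (blockOf x) ρ μ‖ ≤ M) : ‖wt b • pot V x μ‖ ≤ (P.d : ℝ) * M / 2 := by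
  have hL1 : (1 : ℝ) ≤ P.L := by exact_mod_cast P.L_pos
  have hM0 : 0 ≤ M := (norm_nonneg _).trans (hM μ)
  have hd : (0 : ℝ) ≤ P.d := Nat.cast_nonneg _
  have hw : 0 ≤ wt b ∧ wt b ≤ (P.L : ℝ) + 1 := by
    by_cases h : ExitsBlock b
    · rw [wt_of_exits h]; constructor <;> linarith
    · rw [wt_of_not_exits h]; constructor <;> linarith
  rw [norm_smul, Real.norm_of_nonneg hw.1]
  calc wt b * ‖pot V x μ‖ ≤ ((P.L : ℝ) + 1) * ((P.d : ℝ) * (((P.L : ℝ) - 1) / 2) * M / (2 * (P.L : ℝ) ^ 2)) :=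
        mul_le_mul hw.2 (norm_pot_le V x μ hM) (norm_nonneg _) (by linarith)
    _ = (P.d : ℝ) * M / 2 * (((P.L : ℝ) + 1) * ((P.L : ℝ) - 1) / (2 * (P.L : ℝ) ^ 2)) := by ring
    _ ≤ (P.d : ℝ) * M / 2 * 1 := by
        gcongr
        rw [div_le_one (by positivity)]; nlinarith
    _ = _ := by ring

/-- **THE POTENTIAL ONE STEP INSIDE THE BLOCK**: `B_λ(x + e_κ) = B_λ(x) + F_{κλ}(y)/(2L²)` if `⟨x, x+e_κ⟩` does not exit `B(y)`.
[cite: King1986, (A.5) p.676] -/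
theorem pot_shift_of_not_exits (hj : j + 1 ≤ P.m + P.K) (V : GaugeField P (j+1) (Matrix.specialUnitaryGroup (Fin 2) ℂ))
    (x : Site P j) {κ : Fin P.d} (hκ : ¬ ExitsBlock (⟨x, κ⟩ : PBond P j)) (μ : Fin P.d) :
    pot V (x.shift κ) μ = pot V x μ + (1 / (2 * (P.L : ℝ) ^ 2)) • curv V (blockOf x) κ μ := by
  have hblock : blockOf (x.shift κ) = blockOf x := by
    rw [blockOf_shift hj x κ, if_neg]; exact hκ
  have hcoff : ∀ ρ, coff (x.shift κ) ρ = coff x ρ + if ρ = κ then 1 else 0 := by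
    intro ρ
    by_cases h : ρ = κ
    · subst h; rw [if_pos rfl, coff_shift_self_of_not_exits hj x hκ]
    · rw [if_neg h, coff_shift_ne x h, add_zero]
  unfold pot
  rw [hblock, ← smul_add]
  congr 1
  simp_rw [hcoff, add_smul, Finset.sum_add_distrib, ite_smul, one_smul, zero_smul, Finset.sum_ite_eq' Finset.univ κ,
    if_pos (Finset.mem_univ κ)]

/-- **THE POTENTIAL ONE STEP ACROSS THE FACE, TRANSPORTED BACK**: if `⟨x, x+e_κ⟩` exits `B(y)` then
`V(y,κ)·B_λ(x + e_κ)·V(y,κ)* = B_λ(x) − (L−1)F_{κλ}(y)/(2L²) + O(|∇F|)` — the block of `x + e_κ` is `B(y + e_κ)`, its `κ`-offset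
drops by `L − 1`, and `V(y,κ) F(y+e_κ) V(y,κ)* = F(y) + O(|∇F|)`. [cite: King1986, (A.5) p.676] -/
theorem norm_conj_pot_shift_of_exits (hj : j + 1 ≤ P.m + P.K) (V : GaugeField P (j+1) (Matrix.specialUnitaryGroup (Fin 2) ℂ))
    (x : Site P j) {κ : Fin P.d} (hκ : ExitsBlock (⟨x, κ⟩ : PBond P j)) (μ : Fin P.d) {b' : ℝ}
    (hcc : ∀ ρ, ‖((V ⟨blockOf x, κ⟩ : Matrix.specialUnitaryGroup (Fin 2) ℂ) : Matrix (Fin 2) (Fin 2) ℂ) *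
      curv V ((blockOf x).shift κ) ρ μ * star ((V ⟨blockOf x, κ⟩ : Matrix.specialUnitaryGroup (Fin 2) ℂ) : Matrix (Fin 2) (Fin 2) ℂ) -
      curv V (blockOf x) ρ μ‖ ≤ b') :
    ‖((V ⟨blockOf x, κ⟩ : Matrix.specialUnitaryGroup (Fin 2) ℂ) : Matrix (Fin 2) (Fin 2) ℂ) * pot V (x.shift κ) μ *
        star ((V ⟨blockOf x, κ⟩ : Matrix.specialUnitaryGroup (Fin 2) ℂ) : Matrix (Fin 2) (Fin 2) ℂ) -
      (pot V x μ - (((P.L : ℝ) - 1) / (2 * (P.L : ℝ) ^ 2)) • curv V (blockOf x) κ μ)‖ ≤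
      (P.d : ℝ) * ((P.L : ℝ) - 1) * b' / (4 * (P.L : ℝ) ^ 2) := by
  have hL : (0 : ℝ) < P.L := Nat.cast_pos.mpr P.L_pos
  have hb0 : 0 ≤ b' := (norm_nonneg _).trans (hcc μ)
  set y := blockOf x with hy
  set U : Matrix (Fin 2) (Fin 2) ℂ := ((V ⟨y, κ⟩ : Matrix.specialUnitaryGroup (Fin 2) ℂ) : Matrix (Fin 2) (Fin 2) ℂ) with hU
  have hblock : blockOf (x.shift κ) = y.shift κ := by
    rw [hy, blockOf_shift hj x κ, if_pos]; exact hκ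
  have hcoff : ∀ ρ, coff (x.shift κ) ρ = coff x ρ - if ρ = κ then ((P.L : ℝ) - 1) else 0 := by
    intro ρ
    by_cases h : ρ = κ
    · subst h; rw [if_pos rfl, coff_shift_self_of_exits hj x hκ]
    · rw [if_neg h, coff_shift_ne x h, sub_zero]
  -- the error terms `E_ρ = U F(y') U* − F(y)`
  set E : Fin P.d → Matrix (Fin 2) (Fin 2) ℂ := fun ρ => U * curv V (y.shift κ) ρ μ * star U - curv V y ρ μ with hE
  have hEρ : ∀ ρ, curv V y ρ μ + E ρ = U * curv V (y.shift κ) ρ μ * star U := fun ρ => by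
    show curv V y ρ μ + (U * curv V (y.shift κ) ρ μ * star U - curv V y ρ μ) = _
    rw [add_comm, sub_add_cancel]
  have hconj : U * pot V (x.shift κ) μ * star U =
      (1 / (2 * (P.L : ℝ) ^ 2)) • ∑ ρ : Fin P.d, coff (x.shift κ) ρ • (curv V y ρ μ + E ρ) := by
    unfold pot
    rw [hblock, Matrix.mul_smul, Matrix.smul_mul, Finset.mul_sum, Finset.sum_mul]
    congr 1
    refine Finset.sum_congr rfl fun ρ _ => ?_
    rw [Matrix.mul_smul, Matrix.smul_mul, hEρ]
  have hmain : (1 / (2 * (P.L : ℝ) ^ 2)) • ∑ ρ : Fin P.d, coff (x.shift κ) ρ • curv V y ρ μ =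
      pot V x μ - (((P.L : ℝ) - 1) / (2 * (P.L : ℝ) ^ 2)) • curv V y κ μ := by
    unfold pot
    rw [← hy]
    simp_rw [hcoff, sub_smul, Finset.sum_sub_distrib, ite_smul, zero_smul, Finset.sum_ite_eq' Finset.univ κ,
      if_pos (Finset.mem_univ κ), smul_sub, smul_smul]
    congr 2
    field_simp
  have hsplit : U * pot V (x.shift κ) μ * star U -
      (pot V x μ - (((P.L : ℝ) - 1) / (2 * (P.L : ℝ) ^ 2)) • curv V y κ μ) =
      (1 / (2 * (P.L : ℝ) ^ 2)) • ∑ ρ : Fin P.d, coff (x.shift κ) ρ • E ρ := by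
    rw [hconj, ← hmain, ← smul_sub, ← Finset.sum_sub_distrib]
    congr 1
    refine Finset.sum_congr rfl fun ρ _ => ?_
    rw [smul_add]; abel
  rw [hsplit, norm_smul, Real.norm_of_nonneg (by positivity)]
  have hsum : ‖∑ ρ : Fin P.d, coff (x.shift κ) ρ • E ρ‖ ≤ (P.d : ℝ) * (((P.L : ℝ) - 1) / 2 * b') := by
    calc ‖∑ ρ : Fin P.d, coff (x.shift κ) ρ • E ρ‖ ≤ ∑ ρ : Fin P.d, ‖coff (x.shift κ) ρ • E ρ‖ := norm_sum_le _ _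
      _ ≤ ∑ _ρ : Fin P.d, ((P.L : ℝ) - 1) / 2 * b' := Finset.sum_le_sum fun ρ _ => by
          rw [norm_smul, Real.norm_eq_abs]
          exact mul_le_mul (abs_coff_le _ ρ) (hcc ρ) (norm_nonneg _) (by linarith [abs_nonneg (coff (x.shift κ) ρ), abs_coff_le (x.shift κ) ρ])
      _ = _ := by rw [Finset.sum_const, Finset.card_univ, Fintype.card_fin, nsmul_eq_mul]
  calc 1 / (2 * (P.L : ℝ) ^ 2) * ‖∑ ρ : Fin P.d, coff (x.shift κ) ρ • E ρ‖
      ≤ 1 / (2 * (P.L : ℝ) ^ 2) * ((P.d : ℝ) * (((P.L : ℝ) - 1) / 2 * b')) := by gcongr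
    _ = _ := by ring

end Sizes

section Structure

variable {P : Params} {j : ℕ}

/-- **THE FIVE EXPONENTS SUM TO `F_{κλ}(y)/L²` UP TO `O(|∇F|)`** — in each of the four exit configurations of `p = ⟨x, κ, λ⟩`
(weights `1, L+1`; offset jumps `+1` inside, `−(L−1)` across a face; the coarse plaquette at the edge). [cite: King1986, (A.5) p.676] -/
theorem exists_sum_exponents (hj : j + 1 ≤ P.m + P.K) (V : GaugeField P (j+1) (Matrix.specialUnitaryGroup (Fin 2) ℂ))
    {a b' : ℝ} (hb' : 0 ≤ b') (ha3 : a ≤ 1 / 3)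
    (hV : ∀ (y : Site P (j+1)) (κ μ : Fin P.d),
      ‖((plaqElt V y κ μ : Matrix.specialUnitaryGroup (Fin 2) ℂ) : Matrix (Fin 2) (Fin 2) ℂ) - 1‖ ≤ a)
    (hcc : ∀ (y : Site P (j+1)) (κ ρ μ : Fin P.d),
      ‖((V ⟨y, κ⟩ : Matrix.specialUnitaryGroup (Fin 2) ℂ) : Matrix (Fin 2) (Fin 2) ℂ) * curv V (y.shift κ) ρ μ *
          star ((V ⟨y, κ⟩ : Matrix.specialUnitaryGroup (Fin 2) ℂ) : Matrix (Fin 2) (Fin 2) ℂ) - curv V y ρ μ‖ ≤ b')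
    (p : Plaq P j) :
    ∃ E : Matrix (Fin 2) (Fin 2) ℂ,
      wt ⟨p.src, p.μ⟩ • pot V p.src p.μ +
        ((faceSec V ⟨p.src, p.μ⟩ : Matrix.specialUnitaryGroup (Fin 2) ℂ) : Matrix (Fin 2) (Fin 2) ℂ) *
            (wt ⟨p.src.shift p.μ, p.ν⟩ • pot V (p.src.shift p.μ) p.ν) *
            star ((faceSec V ⟨p.src, p.μ⟩ : Matrix.specialUnitaryGroup (Fin 2) ℂ) : Matrix (Fin 2) (Fin 2) ℂ) +
        mlog ((GaugeField.plaqHol (faceSec V) p : Matrix.specialUnitaryGroup (Fin 2) ℂ) : Matrix (Fin 2) (Fin 2) ℂ) +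
        -(((faceSec V ⟨p.src, p.ν⟩ : Matrix.specialUnitaryGroup (Fin 2) ℂ) : Matrix (Fin 2) (Fin 2) ℂ) *
            (wt ⟨p.src.shift p.ν, p.μ⟩ • pot V (p.src.shift p.ν) p.μ) *
            star ((faceSec V ⟨p.src, p.ν⟩ : Matrix.specialUnitaryGroup (Fin 2) ℂ) : Matrix (Fin 2) (Fin 2) ℂ)) +
        -(wt ⟨p.src, p.ν⟩ • pot V p.src p.ν) =
      (1 / (P.L : ℝ) ^ 2) • curv V (blockOf p.src) p.μ p.ν + E ∧ ‖E‖ ≤ (P.d : ℝ) * b' / 2 := by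
  have hL : (0 : ℝ) < P.L := Nat.cast_pos.mpr P.L_pos
  have hL1 : (1 : ℝ) ≤ P.L := by exact_mod_cast P.L_pos
  have hLne : (P.L : ℝ) ≠ 0 := hL.ne'
  have hd0 : (0 : ℝ) ≤ P.d := Nat.cast_nonneg _
  set x := p.src with hx
  set κ := p.μ with hκ_def
  set μ := p.ν with hμ_def
  set y := blockOf x with hy
  have hne : μ ≠ κ := (ne_of_lt p.hμν).symm
  have hne' : κ ≠ μ := ne_of_lt p.hμν
  set c := curv V y κ μ with hc_def
  have hcswap : curv V y μ κ = -c := curv_swap V y κ μ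
  have hexit2 : ExitsBlock (⟨x.shift κ, μ⟩ : PBond P j) ↔ ExitsBlock (⟨x, μ⟩ : PBond P j) := exitsBlock_shift_ne x hne
  have hexit3 : ExitsBlock (⟨x.shift μ, κ⟩ : PBond P j) ↔ ExitsBlock (⟨x, κ⟩ : PBond P j) := exitsBlock_shift_ne x hne'
  -- the two possible error sizes
  set e : ℝ := (P.d : ℝ) * ((P.L : ℝ) - 1) * b' / (4 * (P.L : ℝ) ^ 2) with he
  have he1 : ((P.L : ℝ) + 1) * e ≤ (P.d : ℝ) * b' / 4 := by
    rw [he, show ((P.L : ℝ) + 1) * ((P.d : ℝ) * ((P.L : ℝ) - 1) * b' / (4 * (P.L : ℝ) ^ 2)) =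
      (P.d : ℝ) * b' / 4 * (((P.L : ℝ) + 1) * ((P.L : ℝ) - 1) / (P.L : ℝ) ^ 2) by ring]
    refine mul_le_of_le_one_right (by positivity) ?_
    rw [div_le_one (by positivity)]; nlinarith
  have he2 : e ≤ (P.d : ℝ) * b' / 2 := by
    rw [he, show (P.d : ℝ) * ((P.L : ℝ) - 1) * b' / (4 * (P.L : ℝ) ^ 2) = (P.d : ℝ) * b' / 2 * (((P.L : ℝ) - 1) / (2 * (P.L : ℝ) ^ 2)) by ring]
    refine mul_le_of_le_one_right (by positivity) ?_
    rw [div_le_one (by positivity)]; nlinarith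
  set r : ℝ := ((P.L : ℝ) - 1) / (2 * (P.L : ℝ) ^ 2) with hr
  set t : ℝ := 1 / (2 * (P.L : ℝ) ^ 2) with ht
  by_cases hκe : ExitsBlock (⟨x, κ⟩ : PBond P j) <;> by_cases hμe : ExitsBlock (⟨x, μ⟩ : PBond P j)
  · -- EDGE
    set E₂ := ((V ⟨y, κ⟩ : Matrix.specialUnitaryGroup (Fin 2) ℂ) : Matrix (Fin 2) (Fin 2) ℂ) * pot V (x.shift κ) μ *
        star ((V ⟨y, κ⟩ : Matrix.specialUnitaryGroup (Fin 2) ℂ) : Matrix (Fin 2) (Fin 2) ℂ) - (pot V x μ - r • c) with hE₂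
    set E₃ := ((V ⟨y, μ⟩ : Matrix.specialUnitaryGroup (Fin 2) ℂ) : Matrix (Fin 2) (Fin 2) ℂ) * pot V (x.shift μ) κ *
        star ((V ⟨y, μ⟩ : Matrix.specialUnitaryGroup (Fin 2) ℂ) : Matrix (Fin 2) (Fin 2) ℂ) - (pot V x κ - r • curv V y μ κ) with hE₃
    have hE₂n : ‖E₂‖ ≤ e := norm_conj_pot_shift_of_exits hj V x hκe μ (fun ρ => hcc y κ ρ μ)
    have hE₃n : ‖E₃‖ ≤ e := norm_conj_pot_shift_of_exits hj V x hμe κ (fun ρ => hcc y μ ρ κ)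
    have e2 : ((V ⟨y, κ⟩ : Matrix.specialUnitaryGroup (Fin 2) ℂ) : Matrix (Fin 2) (Fin 2) ℂ) * pot V (x.shift κ) μ *
        star ((V ⟨y, κ⟩ : Matrix.specialUnitaryGroup (Fin 2) ℂ) : Matrix (Fin 2) (Fin 2) ℂ) = pot V x μ - r • c + E₂ := by
      rw [hE₂, add_sub_cancel]
    have e3 : ((V ⟨y, μ⟩ : Matrix.specialUnitaryGroup (Fin 2) ℂ) : Matrix (Fin 2) (Fin 2) ℂ) * pot V (x.shift μ) κ *
        star ((V ⟨y, μ⟩ : Matrix.specialUnitaryGroup (Fin 2) ℂ) : Matrix (Fin 2) (Fin 2) ℂ) = pot V x κ + r • c + E₃ := by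
      rw [hE₃, hcswap, smul_neg, sub_neg_eq_add, add_sub_cancel]
    have hq : mlog ((GaugeField.plaqHol (faceSec V) p : Matrix.specialUnitaryGroup (Fin 2) ℂ) : Matrix (Fin 2) (Fin 2) ℂ) = c := by
      rw [plaqHol_faceSec hj V p, if_pos ⟨hκe, hμe⟩, ← plaqElt_eq_plaqHol, hc_def, hy, hx, curv_of_small]
      exact (hV _ _ _).trans ha3
    refine ⟨((P.L : ℝ) + 1) • E₂ - ((P.L : ℝ) + 1) • E₃, ?_, ?_⟩
    · rw [faceSec_of_exits V hκe, faceSec_of_exits V hμe, wt_of_exits hκe, wt_of_exits hμe, wt_of_exits (hexit2.mpr hμe),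
        wt_of_exits (hexit3.mpr hκe), hq, Matrix.mul_smul, Matrix.smul_mul, Matrix.mul_smul, Matrix.smul_mul]
      change ((P.L : ℝ) + 1) • pot V x κ + ((P.L : ℝ) + 1) • (((V ⟨y, κ⟩ : Matrix.specialUnitaryGroup (Fin 2) ℂ) : Matrix (Fin 2) (Fin 2) ℂ) *
          pot V (x.shift κ) μ * star ((V ⟨y, κ⟩ : Matrix.specialUnitaryGroup (Fin 2) ℂ) : Matrix (Fin 2) (Fin 2) ℂ)) + c +
          -(((P.L : ℝ) + 1) • (((V ⟨y, μ⟩ : Matrix.specialUnitaryGroup (Fin 2) ℂ) : Matrix (Fin 2) (Fin 2) ℂ) *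
            pot V (x.shift μ) κ * star ((V ⟨y, μ⟩ : Matrix.specialUnitaryGroup (Fin 2) ℂ) : Matrix (Fin 2) (Fin 2) ℂ))) +
          -(((P.L : ℝ) + 1) • pot V x μ) = _
      rw [e2, e3, alg_edge]
      congr 1
      rw [hr]; congr 1; field_simp; ring
    · calc ‖((P.L : ℝ) + 1) • E₂ - ((P.L : ℝ) + 1) • E₃‖ ≤ ‖((P.L : ℝ) + 1) • E₂‖ + ‖((P.L : ℝ) + 1) • E₃‖ := norm_sub_le _ _
        _ ≤ (P.d : ℝ) * b' / 4 + (P.d : ℝ) * b' / 4 := by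
            rw [norm_smul, norm_smul, Real.norm_of_nonneg (by linarith)]
            exact add_le_add ((mul_le_mul_of_nonneg_left hE₂n (by linarith)).trans he1)
              ((mul_le_mul_of_nonneg_left hE₃n (by linarith)).trans he1)
        _ = (P.d : ℝ) * b' / 2 := by ring
  · -- FACE κ
    set E₂ := ((V ⟨y, κ⟩ : Matrix.specialUnitaryGroup (Fin 2) ℂ) : Matrix (Fin 2) (Fin 2) ℂ) * pot V (x.shift κ) μ *
        star ((V ⟨y, κ⟩ : Matrix.specialUnitaryGroup (Fin 2) ℂ) : Matrix (Fin 2) (Fin 2) ℂ) - (pot V x μ - r • c) with hE₂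
    have hE₂n : ‖E₂‖ ≤ e := norm_conj_pot_shift_of_exits hj V x hκe μ (fun ρ => hcc y κ ρ μ)
    have e2 : ((V ⟨y, κ⟩ : Matrix.specialUnitaryGroup (Fin 2) ℂ) : Matrix (Fin 2) (Fin 2) ℂ) * pot V (x.shift κ) μ *
        star ((V ⟨y, κ⟩ : Matrix.specialUnitaryGroup (Fin 2) ℂ) : Matrix (Fin 2) (Fin 2) ℂ) = pot V x μ - r • c + E₂ := by
      rw [hE₂, add_sub_cancel]
    have e3 : pot V (x.shift μ) κ = pot V x κ - t • c := by
      rw [pot_shift_of_not_exits hj V x hμe κ, ← hy, hcswap, smul_neg, sub_eq_add_neg]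
    have hq : mlog ((GaugeField.plaqHol (faceSec V) p : Matrix.specialUnitaryGroup (Fin 2) ℂ) : Matrix (Fin 2) (Fin 2) ℂ) = 0 := by
      rw [plaqHol_faceSec hj V p, if_neg (fun h => hμe h.2)]; exact mlog_one
    refine ⟨E₂, ?_, hE₂n.trans he2⟩
    rw [faceSec_of_exits V hκe, faceSec_of_not_exits V hμe, wt_of_exits hκe, wt_of_not_exits hμe,
      wt_of_not_exits (fun h => hμe (hexit2.mp h)), wt_of_exits (hexit3.mpr hκe), hq, one_smul, one_smul, e2, e3]
    change ((P.L : ℝ) + 1) • pot V x κ + (pot V x μ - r • c + E₂) + 0 +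
        -((((1 : Matrix.specialUnitaryGroup (Fin 2) ℂ)) : Matrix (Fin 2) (Fin 2) ℂ) * (((P.L : ℝ) + 1) • (pot V x κ - t • c)) *
          star (((1 : Matrix.specialUnitaryGroup (Fin 2) ℂ)) : Matrix (Fin 2) (Fin 2) ℂ)) + -pot V x μ = _
    rw [OneMemClass.coe_one, star_one, one_mul, mul_one, alg_face₁]
    congr 1
    rw [hr, ht]; field_simp; ring
  · -- FACE λ
    set E₃ := ((V ⟨y, μ⟩ : Matrix.specialUnitaryGroup (Fin 2) ℂ) : Matrix (Fin 2) (Fin 2) ℂ) * pot V (x.shift μ) κ *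
        star ((V ⟨y, μ⟩ : Matrix.specialUnitaryGroup (Fin 2) ℂ) : Matrix (Fin 2) (Fin 2) ℂ) - (pot V x κ - r • curv V y μ κ) with hE₃
    have hE₃n : ‖E₃‖ ≤ e := norm_conj_pot_shift_of_exits hj V x hμe κ (fun ρ => hcc y μ ρ κ)
    have e3 : ((V ⟨y, μ⟩ : Matrix.specialUnitaryGroup (Fin 2) ℂ) : Matrix (Fin 2) (Fin 2) ℂ) * pot V (x.shift μ) κ *
        star ((V ⟨y, μ⟩ : Matrix.specialUnitaryGroup (Fin 2) ℂ) : Matrix (Fin 2) (Fin 2) ℂ) = pot V x κ + r • c + E₃ := by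
      rw [hE₃, hcswap, smul_neg, sub_neg_eq_add, add_sub_cancel]
    have e2 : pot V (x.shift κ) μ = pot V x μ + t • c := by
      rw [pot_shift_of_not_exits hj V x hκe μ, ← hy]
    have hq : mlog ((GaugeField.plaqHol (faceSec V) p : Matrix.specialUnitaryGroup (Fin 2) ℂ) : Matrix (Fin 2) (Fin 2) ℂ) = 0 := by
      rw [plaqHol_faceSec hj V p, if_neg (fun h => hκe h.1)]; exact mlog_one
    refine ⟨-E₃, ?_, by rw [norm_neg]; exact hE₃n.trans he2⟩
    rw [faceSec_of_not_exits V hκe, faceSec_of_exits V hμe, wt_of_not_exits hκe, wt_of_exits hμe,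
      wt_of_exits (hexit2.mpr hμe), wt_of_not_exits (fun h => hκe (hexit3.mp h)), hq, one_smul, one_smul, e2, e3]
    change pot V x κ + (((1 : Matrix.specialUnitaryGroup (Fin 2) ℂ)) : Matrix (Fin 2) (Fin 2) ℂ) * (((P.L : ℝ) + 1) • (pot V x μ + t • c)) *
        star (((1 : Matrix.specialUnitaryGroup (Fin 2) ℂ)) : Matrix (Fin 2) (Fin 2) ℂ) + 0 + -(pot V x κ + r • c + E₃) +
        -(((P.L : ℝ) + 1) • pot V x μ) = _
    rw [OneMemClass.coe_one, star_one, one_mul, mul_one, alg_face₂]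
    congr 1
    rw [hr, ht]; field_simp; ring
  · -- INTERIOR
    have e2 : pot V (x.shift κ) μ = pot V x μ + t • c := by
      rw [pot_shift_of_not_exits hj V x hκe μ, ← hy]
    have e3 : pot V (x.shift μ) κ = pot V x κ - t • c := by
      rw [pot_shift_of_not_exits hj V x hμe κ, ← hy, hcswap, smul_neg, sub_eq_add_neg]
    have hq : mlog ((GaugeField.plaqHol (faceSec V) p : Matrix.specialUnitaryGroup (Fin 2) ℂ) : Matrix (Fin 2) (Fin 2) ℂ) = 0 := by
      rw [plaqHol_faceSec hj V p, if_neg (fun h => hκe h.1)]; exact mlog_one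
    refine ⟨0, ?_, by rw [norm_zero]; positivity⟩
    rw [faceSec_of_not_exits V hκe, faceSec_of_not_exits V hμe, wt_of_not_exits hκe, wt_of_not_exits hμe,
      wt_of_not_exits (fun h => hμe (hexit2.mp h)), wt_of_not_exits (fun h => hκe (hexit3.mp h)), hq, one_smul, one_smul,
      one_smul, one_smul, e2, e3]
    change pot V x κ + (((1 : Matrix.specialUnitaryGroup (Fin 2) ℂ)) : Matrix (Fin 2) (Fin 2) ℂ) * (pot V x μ + t • c) *
        star (((1 : Matrix.specialUnitaryGroup (Fin 2) ℂ)) : Matrix (Fin 2) (Fin 2) ℂ) + 0 +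
        -((((1 : Matrix.specialUnitaryGroup (Fin 2) ℂ)) : Matrix (Fin 2) (Fin 2) ℂ) * (pot V x κ - t • c) *
          star (((1 : Matrix.specialUnitaryGroup (Fin 2) ℂ)) : Matrix (Fin 2) (Fin 2) ℂ)) + -pot V x μ = _
    rw [OneMemClass.coe_one, star_one, one_mul, mul_one, one_mul, mul_one, alg_int]
    congr 1
    rw [ht]; field_simp

/-- **THE PLAQUETTE VARIABLES OF THE SMOOTH INTERPOLATION.**  Let `V` be a coarse `SU(2)` field on `T^{(j+1)}` (standing range
`j + 1 ≤ m + K`) with `|V(∂p) − 1| ≤ a` for all (ordered) coarse plaquettes, `(4d + 2)a ≤ 1`, and covariant-constancy defect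
`‖V(y,κ) F_{ρλ}(y + e_κ) V(y,κ)* − F_{ρλ}(y)‖ ≤ b′` for all `y, κ, ρ, λ`.  Then EVERY fine plaquette `p = ⟨x, κ, λ⟩`, `x ∈ B(y)` —
interior, face or edge — of the interpolation satisfies `‖interp V (∂p) − exp(F_{κλ}(y)/L²)‖ ≤ 2((4d+2)a)² + 3d·b′`: the block's
coarse curvature is SPREAD UNIFORMLY over its `L^d` fine plaquettes of each plane, to second order. [cite: King1986, (A.5) p.676] -/
theorem norm_plaqHol_interp_sub_exp_le (hj : j + 1 ≤ P.m + P.K) (V : GaugeField P (j+1) (Matrix.specialUnitaryGroup (Fin 2) ℂ))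
    {a b' : ℝ} (ha : 0 ≤ a) (hb' : 0 ≤ b') (ha1 : (4 * (P.d : ℝ) + 2) * a ≤ 1)
    (hV : ∀ (y : Site P (j+1)) (κ μ : Fin P.d),
      ‖((plaqElt V y κ μ : Matrix.specialUnitaryGroup (Fin 2) ℂ) : Matrix (Fin 2) (Fin 2) ℂ) - 1‖ ≤ a)
    (hcc : ∀ (y : Site P (j+1)) (κ ρ μ : Fin P.d),
      ‖((V ⟨y, κ⟩ : Matrix.specialUnitaryGroup (Fin 2) ℂ) : Matrix (Fin 2) (Fin 2) ℂ) * curv V (y.shift κ) ρ μ *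
          star ((V ⟨y, κ⟩ : Matrix.specialUnitaryGroup (Fin 2) ℂ) : Matrix (Fin 2) (Fin 2) ℂ) - curv V y ρ μ‖ ≤ b')
    (p : Plaq P j) :
    ‖((GaugeField.plaqHol (interp V) p : Matrix.specialUnitaryGroup (Fin 2) ℂ) : Matrix (Fin 2) (Fin 2) ℂ) -
        exp ((1 / (P.L : ℝ) ^ 2) • curv V (blockOf p.src) p.μ p.ν)‖ ≤
      2 * ((4 * (P.d : ℝ) + 2) * a) ^ 2 + 3 * (P.d : ℝ) * b' := by
  letI : NormedAlgebra ℚ (Matrix (Fin 2) (Fin 2) ℂ) := NormedAlgebra.restrictScalars ℚ ℂ _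
  have hL : (0 : ℝ) < P.L := Nat.cast_pos.mpr P.L_pos
  have hL1 : (1 : ℝ) ≤ P.L := by exact_mod_cast P.L_pos
  have hd1 : (1 : ℝ) ≤ P.d := by exact_mod_cast P.hd
  have hd0 : (0 : ℝ) ≤ P.d := by linarith
  have ha6 : a ≤ 1 / 6 := by nlinarith
  set c := curv V (blockOf p.src) p.μ p.ν with hc_def
  -- sizes of the curvature and of the potentials
  have hc2 : ∀ (z : Site P (j+1)) (ρ ν : Fin P.d), ‖curv V z ρ ν‖ ≤ 2 * a := fun z ρ ν =>
    (norm_curv_le V z ρ ν).trans (by linarith [hV z ρ ν])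
  have hpot : ∀ (b : PBond P j) (z : Site P j) (ν : Fin P.d), ‖wt b • pot V z ν‖ ≤ (P.d : ℝ) * a := fun b z ν =>
    (norm_wt_smul_pot_le V b z ν (fun ρ => hc2 _ ρ ν)).trans (by linarith)
  -- the plaquette of the face section: a coarse plaquette or `1`
  have hQ : ‖((GaugeField.plaqHol (faceSec V) p : Matrix.specialUnitaryGroup (Fin 2) ℂ) : Matrix (Fin 2) (Fin 2) ℂ) - 1‖ ≤ a := by
    rw [plaqHol_faceSec hj V p]
    split_ifs
    · rw [← plaqElt_eq_plaqHol]; exact hV _ _ _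
    · simp [ha]
  have hQ1 : ‖((GaugeField.plaqHol (faceSec V) p : Matrix.specialUnitaryGroup (Fin 2) ℂ) : Matrix (Fin 2) (Fin 2) ℂ) - 1‖ < 1 :=
    hQ.trans_lt (by linarith)
  rw [coe_plaqHol_interp V p hQ1]
  -- the five exponents
  set J₁ : Matrix (Fin 2) (Fin 2) ℂ := ((faceSec V ⟨p.src, p.μ⟩ : Matrix.specialUnitaryGroup (Fin 2) ℂ) : Matrix (Fin 2) (Fin 2) ℂ) with hJ₁
  set J₄ : Matrix (Fin 2) (Fin 2) ℂ := ((faceSec V ⟨p.src, p.ν⟩ : Matrix.specialUnitaryGroup (Fin 2) ℂ) : Matrix (Fin 2) (Fin 2) ℂ) with hJ₄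
  set Y₁ := wt ⟨p.src, p.μ⟩ • pot V p.src p.μ with hY₁
  set Y₂ := J₁ * (wt ⟨p.src.shift p.μ, p.ν⟩ • pot V (p.src.shift p.μ) p.ν) * star J₁ with hY₂
  set Y₃ := mlog ((GaugeField.plaqHol (faceSec V) p : Matrix.specialUnitaryGroup (Fin 2) ℂ) : Matrix (Fin 2) (Fin 2) ℂ) with hY₃
  set Y₄ := -(J₄ * (wt ⟨p.src.shift p.ν, p.μ⟩ • pot V (p.src.shift p.ν) p.μ) * star J₄) with hY₄
  set Y₅ := -(wt ⟨p.src, p.ν⟩ • pot V p.src p.ν) with hY₅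
  set l : List (Matrix (Fin 2) (Fin 2) ℂ) := [Y₁, Y₂, Y₃, Y₄, Y₅] with hl
  have n1 : ‖Y₁‖ ≤ (P.d : ℝ) * a := hpot _ _ _
  have n2 : ‖Y₂‖ ≤ (P.d : ℝ) * a := by rw [hY₂, hJ₁, norm_conj_eq]; exact hpot _ _ _
  have n3 : ‖Y₃‖ ≤ 2 * a := (norm_mlog_le_two_mul (hQ.trans (by linarith))).trans (by linarith)
  have n4 : ‖Y₄‖ ≤ (P.d : ℝ) * a := by rw [hY₄, norm_neg, hJ₄, norm_conj_eq]; exact hpot _ _ _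
  have n5 : ‖Y₅‖ ≤ (P.d : ℝ) * a := by rw [hY₅, norm_neg]; exact hpot _ _ _
  have hT : (l.map (‖·‖)).sum ≤ (4 * (P.d : ℝ) + 2) * a := by
    simp only [hl, List.map_cons, List.map_nil, List.sum_cons, List.sum_nil]
    linarith
  have hT1 : (l.map (‖·‖)).sum ≤ 1 := hT.trans ha1
  have hT0 : 0 ≤ (l.map (‖·‖)).sum :=
    List.sum_nonneg (by intro t ht; obtain ⟨z, -, rfl⟩ := List.mem_map.1 ht; exact norm_nonneg _)
  -- (a) the product is the exponential of the sum to second order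
  have hA : ‖(l.map exp).prod - exp l.sum‖ ≤ 2 * ((4 * (P.d : ℝ) + 2) * a) ^ 2 :=
    (norm_prod_exp_sub_exp_sum_le l hT1).trans (by gcongr)
  -- (b) the sum of the exponents
  obtain ⟨E, hE, hEn⟩ := exists_sum_exponents hj V hb' (by linarith) hV hcc p
  have hlsum : l.sum = (1 / (P.L : ℝ) ^ 2) • c + E := by
    rw [← hE]
    simp only [hl, List.sum_cons, List.sum_nil, add_zero, hY₁, hY₂, hY₃, hY₄, hY₅, hJ₁, hJ₄]
    abel
  -- (c) replacing the sum by `c/L²`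
  have hcn : ‖(1 / (P.L : ℝ) ^ 2) • c‖ ≤ 1 := by
    rw [norm_smul, Real.norm_of_nonneg (by positivity)]
    have h1 : 1 / (P.L : ℝ) ^ 2 ≤ 1 := by rw [div_le_one (by positivity)]; nlinarith
    calc 1 / (P.L : ℝ) ^ 2 * ‖c‖ ≤ 1 * (2 * a) := mul_le_mul h1 (hc2 _ _ _) (norm_nonneg _) zero_le_one
      _ ≤ 1 := by linarith
  have hsn : ‖l.sum‖ ≤ 1 := (Summit.QuantumFields.BalabanUV.Beta.EriceAxialGaugeWords.norm_list_sum_le l).trans hT1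
  have hC : ‖exp l.sum - exp ((1 / (P.L : ℝ) ^ 2) • c)‖ ≤ 3 * (P.d : ℝ) * b' := by
    have h := Literature.Analysis.Complex.norm_exp_sub_exp_le l.sum ((1 / (P.L : ℝ) ^ 2) • c)
    have hdiff : l.sum - (1 / (P.L : ℝ) ^ 2) • c = E := by rw [hlsum]; abel
    rw [hdiff] at h
    have hmax : max ‖l.sum‖ ‖(1 / (P.L : ℝ) ^ 2) • c‖ ≤ 1 := max_le hsn hcn
    have hexp : Real.exp (max ‖l.sum‖ ‖(1 / (P.L : ℝ) ^ 2) • c‖) ≤ 3 :=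
      (Real.exp_le_exp.mpr hmax).trans (by have := Real.exp_one_lt_d9; linarith)
    calc _ ≤ ‖E‖ * Real.exp (max ‖l.sum‖ ‖(1 / (P.L : ℝ) ^ 2) • c‖) := h
      _ ≤ ((P.d : ℝ) * b' / 2) * 3 := mul_le_mul hEn hexp (by positivity) (by positivity)
      _ ≤ 3 * (P.d : ℝ) * b' := by nlinarith
  -- assemble
  have hsplit : (l.map exp).prod - exp ((1 / (P.L : ℝ) ^ 2) • c) =
      ((l.map exp).prod - exp l.sum) + (exp l.sum - exp ((1 / (P.L : ℝ) ^ 2) • c)) := by abel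
  rw [hsplit]
  exact (norm_add_le _ _).trans (add_le_add hA hC)

end Structure

end Summit.QuantumFields.YangMills.Theorems.SmoothLiftInterp

end
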